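import Summits.HodgeConjecture.HodgeConjecture.Theses.CurveNetMordellWeil
import Literature.AlgebraicGeometry.HodgeTheory.MiddleDimensionReductionOfHodgeModels
import Literature.AlgebraicGeometry.HodgeTheory.MiddleDimensionReductionHolds
import Literature.AlgebraicGeometry.HodgeTheory.CupPreservesHodgeTypeOfDeRham
import Literature.AlgebraicGeometry.HodgeTheory.SupportedHodgeClassDescent
import Literature.AlgebraicGeometry.HodgeTheory.GysinFormalismPushforward
import Literature.AlgebraicGeometry.Resolution.ProjectiveResolutionProofs
import Literature.AlgebraicGeometry.Motives.FiniteProjectionExists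

/-!
# Route CurveNetMordellWeil — `VerticalSupportAboveMiddle` AS TYPED is Hodge-conjecture-hard
(evidence for item stmt-HodgeConjecture-2785; helpers `--supports` it)

The support item `VerticalSupportAboveMiddle` quantifies over EVERY surjective
`pr : X ⟶ ℙᵐ` (`m + 1 = dim X`), with no connectedness hypothesis on the fibres. This file proves,
on the tree's real carriers and with NO unproved input besides the item itself, that the item then
contains the Hodge conjecture for middle-degree classes "modulo coniveau one" on every
even-dimensional smooth projective variety mapping onto a projective space of its own dimension —
and hence (granted the catalogued descent theorems of Deligne / Voisin and the Hodge conjecture in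
dimension `≤ 3`) the Hodge conjecture for `(2,2)`-classes on every such fourfold:

* `verticalSupportAboveMiddle_hardness` — let `B` be smooth projective of dimension `2p`, `p ≥ 1`,
  `τ : B ⟶ ℙ²ᵖ` surjective, `c ∈ H²ᵖ(B(ℂ); ℂ)` a rational `(p,p)`-class. On the `(2p+1)`-fold
  `V = B × ℙ¹` the composite `pr = pr₁ ≫ τ : V ⟶ ℙ²ᵖ` is a surjection with DISCONNECTED general
  fibres (`deg τ` copies of `ℙ¹`), and `c' = pr₁^* c ∪ pr₂^* ρ` (`ρ ≠ 0` a rational top class of `ℙ¹`)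
  is a rational `(p+1, p+1)`-class of degree `2(p+1) = dim V + 1 > dim V`; the item says
  `c' ∈ N^{p+1} + span{classes dying off pr⁻¹(ℙ²ᵖ ∖ T), T ⊊ ℙ²ᵖ closed}`; pushing down by the
  Gysin morphism `pr₁_*` (which maps `N^{p+1}H^{2p+2}(V)` into `NᵖH²ᵖ(B)`, is compatible with
  supports, and satisfies `pr₁_* c' = λ c`, `λ ≠ 0`, by the projection formula) gives
  `c ∈ algebraicClasses B p ⊔ span{w | w dies off B ∖ τ⁻¹T, T ⊊ ℙ²ᵖ closed}`;
* `verticalSupportAboveMiddle_coniveau_one` — in particular every rational `(p,p)`-class on such a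
  `B` has coniveau `≥ 1` (`c ∈ N¹H²ᵖ(B(ℂ); ℂ)`), i.e. dies off a proper Zariski-closed subset;
* `verticalSupportAboveMiddle_fourfolds` — for `p = 2`: granted Deligne's theorem on the kernel of
  restriction (Hodge III 8.2.8, `Deligne1974_ker_restrictCompl_eq_iSup_range_complexGysin`), the
  Hodge-class lift along Gysin surjections (`Voisin2025_hodgeClass_lift_complexGysin`) and the Hodge
  conjecture in dimension `≤ 3` (all catalogued named facts of the tree; Hironaka is the tree's
  theorem `Hironaka1964_projective_holds`), every rational `(2,2)`-class on every smooth projective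
  fourfold `B` with a surjection `B ⟶ ℙ⁴` (e.g. a finite one: every `B` has such) is ALGEBRAIC —
  the open case of the Hodge conjecture for fourfolds.

So the item as typed is not the advertised "theorem for free": its `2q = n + 1` instances are
Hodge-conjecture-hard. The intended statement needs geometrically connected fibres of `pr` (then
`R²pr_*ℚ ≅ ℚ(−1)` over the good locus and the Leray/Artin-vanishing argument of the item's
docstring applies); see the release note of stmt-HodgeConjecture-2785. The product/Gysin
bookkeeping is that of the tree's `mem_algebraicClasses_of_two_mul_add_eq_of_cupPreservesHodgeType`
(BFNP Lemma 48, product half), whose Hodge-theoretic inputs are the tree's theorems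
`nonempty_hodgeModel_holds`, `hodgePQ_independent_of_hodgeModel_holds`,
`exists_deRhamIsoFamily_holds`.
-/

noncomputable section

-- `Summit.HodgeConjecture.HodgeConjecture.Theorems` is the mandated namespace (single-problem summit:
-- Problem = Summit), which `linter.dupNamespace` flags on every declaration; the lakefile turns the
-- linter off tree-wide (weak option), restated here so stand-alone elaboration is warning-free too.
set_option linter.dupNamespace false

open scoped Manifold ContDiff
open CategoryTheory CategoryTheory.Limits AlgebraicGeometry MonoidalCategory CartesianMonoidalCategory
open Literature.AlgebraicGeometry Literature.AlgebraicGeometry.Motives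
  Literature.AlgebraicGeometry.HodgeTheory Literature.AlgebraicTopology.SingularHomology
open Summit.HodgeConjecture.HodgeConjecture.Theses.CurveNetMordellWeil (VerticalSupportAboveMiddle)

namespace Summit.HodgeConjecture.HodgeConjecture.Theorems

/-- **`VerticalSupportAboveMiddle` as typed contains the middle-degree Hodge conjecture modulo
vertical classes.** If the item holds, then for every smooth projective `B` of dimension `2p`
(`p ≥ 1`) with a surjective morphism `τ : B ⟶ ℙ²ᵖ`, every rational `(p,p)`-class `c` on `B` lies in
`algebraicClasses B p ⊔ span{w | w dies off B ∖ τ⁻¹T for some Zariski-closed T ⊊ ℙ²ᵖ}`.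
Proof: apply the item to the surjection `pr₁ ≫ τ : B × ℙ¹ ⟶ ℙ²ᵖ` (dimension `2p + 1`, degree
`2(p+1)`) and the rational `(p+1,p+1)`-class `pr₁^* c ∪ pr₂^* ρ`, then push down by `pr₁_*`
(projection formula `pr₁_*(pr₁^* c ∪ pr₂^* ρ) = λ c`, `λ ≠ 0`; Gysin images of algebraic classes
are algebraic; Gysin maps are compatible with supports). [folklore] -/
theorem verticalSupportAboveMiddle_hardness (hAbove : VerticalSupportAboveMiddle)
    {p : ℕ} (hp : 1 ≤ p) {B : SchemeOver ℂ} (hB : IsSmoothProjective (2 * p) B)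
    (τ : B ⟶ projectiveSpace (2 * p) ℂ) (hτ : Function.Surjective τ.left.base)
    (c : complexBetti B (2 * p)) (hc : IsRationalClass c)
    (hpp : IsOfHodgeType (2 * p) B (2 * p) p p c) :
    c ∈ algebraicClasses B p ⊔ Submodule.span ℂ {w : complexBetti B (2 * p) |
      ∃ T : Set (projectiveSpace (2 * p) ℂ).left, IsClosed T ∧ T ≠ Set.univ ∧
        complexBetti.restrictCompl B (τ.left.base ⁻¹' T) (2 * p) w = 0} := by
  -- an orientation family and its Poincaré duality; the support fact for Gysin maps (all proved)
  let μ : OrientationFamily := fun n Y hY ↦ (Motives.ComplexPoints.isOrientableOver ℂ hY).some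
  have hμ : μ.HasPoincareDuality := OrientationFamily.hasPoincareDuality μ
  have hS := gysinMap_restrictCompl_eq_zero_of_field.{0, 0} ℂ
  -- the Hodge-theoretic inputs of the product trick (all proved in the tree)
  have hI : hodgePQ_independent_of_hodgeModel := hodgePQ_independent_of_hodgeModel_holds
  have hA : ∀ ⦃n : ℕ⦄ ⦃X : Motives.SchemeOver ℂ⦄, nonempty_hodgeModel n X :=
    fun _ _ ↦ nonempty_hodgeModel_holds
  have hcup : ∀ ⦃n : ℕ⦄ ⦃X : Motives.SchemeOver ℂ⦄, IsSmoothProjective n X →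
      CupPreservesHodgeType n X :=
    fun _ _ hX ↦ cupPreservesHodgeType_of_nonempty_hodgeModel hI (@hA _ _)
      (fun E _ _ _ ↦ Literature.NumberTheory.Transcendental.exists_deRhamIsoFamily_holds E) hX
  -- the auxiliary factor `P = ℙ¹`, a complex point `t`, the odd-dimensional `V = B × P`
  set P := Motives.projectiveSpace 1 ℂ with hPdef
  have hP : IsSmoothProjective 1 P := Motives.isSmoothProjective_projectiveSpace_holds ℂ 1
  haveI := connectedSpace_complexPoints hP
  obtain ⟨t⟩ : Nonempty (Motives.ComplexPoints P) := inferInstance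
  haveI := connectedSpace_complexPoints hB
  obtain ⟨x₀⟩ : Nonempty (Motives.ComplexPoints B) := inferInstance
  have hV : IsSmoothProjective (2 * p + 1) (B ⊗ P) := Motives.IsSmoothProjective.tensor_holds hB hP
  haveI : LocallyOfFiniteType P.hom := locallyOfFiniteType_of_isSmoothProjective hP
  haveI : IsClosedImmersion (Motives.sliceAt B t).left := Motives.isClosedImmersion_sliceAt_left t
  haveI := pathConnectedSpace_complexPoints hB
  -- a non-zero rational top-degree class `ρ` on `P`, of type `(1, 1)`
  obtain ⟨ρ, hρ, hρ0⟩ := exists_isRationalClass_ne_zero_of_degree_eq_two_mul hP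
  obtain ⟨A⟩ := (hA (n := 1) (X := P)).nonempty hP
  have hρtyp : IsOfHodgeType 1 P (2 * 1) 1 1 ρ := isOfHodgeType_of_degree_eq_two_mul A ρ
  -- `pr₂^* ρ` dies off the slice `s_t(B) = pr₂⁻¹(t)` …
  have hρsupp : complexBetti.restrictCompl (B ⊗ P) (Set.range (Motives.sliceAt B t).left.base)
      (2 * 1) (complexBetti.map (snd B P) (2 * 1) ρ) = 0 := by
    rw [range_sliceAt_left_base]
    exact complexBetti.restrictCompl_map_eq_zero (snd B P) (restrictCompl_pt_eq_zero hP le_rfl t ρ)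
  -- … hence is a Gysin image `s_{t*} y`, `y ∈ H⁰(B(ℂ); ℂ) = ℂ · 1`: `pr₂^* ρ = λ · s_{t*} 1`
  obtain ⟨y, hy⟩ := exists_complexGysin_eq_of_isClosedImmersion μ hV hB (Motives.sliceAt B t)
    (show 0 + 2 * (2 * p + 1) = 2 * 1 + 2 * (2 * p) by ring) hρsupp
  obtain ⟨lam, rfl⟩ := singularCohomology.exists_eq_smul_one y
  rw [map_smul] at hy
  -- `λ ≠ 0`: `pr₂^*` is injective (`pr₂` has the section `(x₀, 𝟙)`) and `ρ ≠ 0`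
  have hlam : lam ≠ 0 := by
    rintro rfl
    rw [zero_smul] at hy
    apply hρ0
    let j : P ⟶ B ⊗ P := CartesianMonoidalCategory.lift (Motives.toSpecOver P ≫ x₀) (𝟙 P)
    have hj : j ≫ snd B P = 𝟙 P := CartesianMonoidalCategory.lift_snd _ _
    have hρj : complexBetti.map j (2 * 1) (complexBetti.map (snd B P) (2 * 1) ρ) = ρ := by
      rw [← CategoryTheory.comp_apply, ← complexBetti.map_comp, hj, complexBetti.map_id,
        CategoryTheory.id_apply]
    rw [← hρj, ← hy, map_zero]
  -- the class `c' = pr₁^* c ∪ pr₂^* ρ` on `V`: rational, of type `(p + 1, p + 1)`, degree `2(p+1)`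
  set c' : complexBetti (B ⊗ P) (2 * (p + 1)) :=
    cupProduct (show 2 * p + 2 * 1 = 2 * (p + 1) by ring) (complexBetti.map (fst B P) (2 * p) c)
      (complexBetti.map (snd B P) (2 * 1) ρ) with hc'def
  have hc'rat : IsRationalClass c' := (hc.map _).cup _ (hρ.map _)
  have hc'typ : IsOfHodgeType (2 * p + 1) (B ⊗ P) (2 * (p + 1)) (p + 1) (p + 1) c' :=
    hcup hV _ (preservesHodgeType_of_nonempty_hodgeModel hI (hA (X := B ⊗ P)) hV hB (fst B P) hpp)
      (preservesHodgeType_of_nonempty_hodgeModel hI (hA (X := B ⊗ P)) hV hP (snd B P) hρtyp)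
  -- the surjection `pr = pr₁ ≫ τ : V ⟶ ℙ²ᵖ` (disconnected fibres!)
  have hfst : Function.Surjective (fst B P).left.base := by
    intro b
    refine ⟨(Motives.sliceAt B t).left.base b, ?_⟩
    have h1 : (Motives.sliceAt B t ≫ fst B P).left.base b = b := by
      rw [Motives.sliceAt_fst]
      rfl
    rwa [Over.comp_left, Scheme.Hom.comp_apply] at h1
  have hsurj : Function.Surjective (fst B P ≫ τ).left.base := by
    intro z
    obtain ⟨b, rfl⟩ := hτ z
    obtain ⟨v, rfl⟩ := hfst b
    exact ⟨v, by rw [Over.comp_left, Scheme.Hom.comp_apply]⟩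
  -- THE ITEM, applied at `n = 2p + 1`, `q = p + 1`, `m = 2p`
  have key := hAbove (fst B P ≫ τ) hV (show 2 ≤ p + 1 by omega)
    (show 2 * p + 1 < 2 * (p + 1) by omega) rfl hsurj
  have hc'mem := key (Submodule.subset_span ⟨hc'rat, hc'typ⟩)
  -- push down by `pr₁_*`
  set g := complexGysin μ hV hB (fst B P)
    (show 2 * (p + 1) + 2 * (2 * p) = 2 * p + 2 * (2 * p + 1) by ring) with hgdef
  have hgc' : g c' ∈ algebraicClasses B p ⊔ Submodule.span ℂ {w : complexBetti B (2 * p) |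
      ∃ T : Set (projectiveSpace (2 * p) ℂ).left, IsClosed T ∧ T ≠ Set.univ ∧
        complexBetti.restrictCompl B (τ.left.base ⁻¹' T) (2 * p) w = 0} := by
    obtain ⟨a, ha, s, hs, has⟩ := Submodule.mem_sup.1 hc'mem
    rw [← has, map_add]
    refine Submodule.add_mem_sup ?_ ?_
    · -- Gysin images of algebraic classes are algebraic (coniveau drops by the relative dimension)
      exact complexGysin_mem_algebraicClasses hS μ hμ hV hB (fst B P) (by omega) _ ha
    · -- Gysin maps are compatible with supports: vertical classes go to `τ`-vertical classes
      suffices h : Submodule.span ℂ {c : complexBetti (B ⊗ P) (2 * (p + 1)) |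
          IsRationalClass c ∧ IsOfHodgeType (2 * p + 1) (B ⊗ P) (2 * (p + 1)) (p + 1) (p + 1) c ∧
          ∃ T : Set (projectiveSpace (2 * p) ℂ).left, IsClosed T ∧ T ≠ Set.univ ∧
            complexBetti.restrictCompl (B ⊗ P) ((fst B P ≫ τ).left.base ⁻¹' T) (2 * (p + 1)) c = 0}
          ≤ (Submodule.span ℂ {w : complexBetti B (2 * p) |
            ∃ T : Set (projectiveSpace (2 * p) ℂ).left, IsClosed T ∧ T ≠ Set.univ ∧
              complexBetti.restrictCompl B (τ.left.base ⁻¹' T) (2 * p) w = 0}).comap g from h hs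
      refine Submodule.span_le.2 ?_
      rintro v ⟨-, -, T, hT, hTne, hv⟩
      refine Submodule.subset_span ⟨T, hT, hTne, ?_⟩
      have hpre : (fst B P ≫ τ).left.base ⁻¹' T = (fst B P).left.base ⁻¹' (τ.left.base ⁻¹' T) := by
        ext x
        rw [Set.mem_preimage, Set.mem_preimage, Set.mem_preimage, Over.comp_left,
          Scheme.Hom.comp_apply]
      rw [hpre] at hv
      exact complexGysin_restrictCompl_eq_zero hS μ hμ hV hB (fst B P) _
        (hT.preimage τ.left.base.hom.continuous) v hv
  -- `pr₁_* c' = c ∪ pr₁_* pr₂^* ρ = c ∪ λ · (s_t ≫ pr₁)_* 1 = λ c`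
  have hone : complexGysin μ hV hB (fst B P) (show 2 * 1 + 2 * (2 * p) = 0 + 2 * (2 * p + 1) by ring)
      (complexBetti.map (snd B P) (2 * 1) ρ) = lam • singularCohomology.one ℂ (Motives.ComplexPoints B) := by
    rw [← hy, map_smul, ← LinearMap.comp_apply,
      ← complexGysin_comp hμ hB hV hB (Motives.sliceAt B t) (fst B P)]
    simp only [Motives.sliceAt_fst]
    rw [complexGysin_id hμ hB 0, LinearMap.id_apply]
  have hcc : g c' = lam • c := by
    rw [hgdef, hc'def, complexGysin_cup hμ hV hB (fst B P) _ _
      (show 2 * 1 + 2 * (2 * p) = 0 + 2 * (2 * p + 1) by ring) (Nat.add_zero (2 * p)), hone,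
      LinearMap.map_smul, cupProduct_one]
  rw [hcc] at hgc'
  have h := Submodule.smul_mem _ lam⁻¹ hgc'
  rwa [smul_smul, inv_mul_cancel₀ hlam, one_smul] at h

/-- **Hence every rational middle-degree Hodge class on such a `B` has coniveau `≥ 1`**: if the item
holds, then for `B` smooth projective of dimension `2p` (`p ≥ 1`) with a surjection `τ : B ⟶ ℙ²ᵖ`,
every rational `(p,p)`-class lies in `N¹H²ᵖ(B(ℂ); ℂ) = supportedClasses B (2p) 1` (algebraic classes
have coniveau `p ≥ 1`; a `τ`-vertical class dies off the proper closed `τ⁻¹T`, all of whose points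
have codimension `≥ 1` in the irreducible `B`). For Hodge classes this is the statement
"Hodge ⇒ coniveau ≥ 1", equivalent to the Hodge conjecture on `B` granted it in lower dimension.
[folklore] -/
theorem verticalSupportAboveMiddle_coniveau_one (hAbove : VerticalSupportAboveMiddle)
    {p : ℕ} (hp : 1 ≤ p) {B : SchemeOver ℂ} (hB : IsSmoothProjective (2 * p) B)
    (τ : B ⟶ projectiveSpace (2 * p) ℂ) (hτ : Function.Surjective τ.left.base)
    (c : complexBetti B (2 * p)) (hc : IsRationalClass c)
    (hpp : IsOfHodgeType (2 * p) B (2 * p) p p c) :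
    c ∈ supportedClasses B (2 * p) 1 := by
  have hsub : {w : complexBetti B (2 * p) |
      ∃ T : Set (projectiveSpace (2 * p) ℂ).left, IsClosed T ∧ T ≠ Set.univ ∧
        complexBetti.restrictCompl B (τ.left.base ⁻¹' T) (2 * p) w = 0} ⊆
      supportedClasses B (2 * p) 1 := by
    rintro w ⟨T, hT, hTne, hw⟩
    have hT' : IsClosed (τ.left.base ⁻¹' T) := hT.preimage τ.left.base.hom.continuous
    have hTne' : τ.left.base ⁻¹' T ≠ Set.univ := by
      intro hU
      apply hTne
      refine Set.eq_univ_of_forall fun z ↦ ?_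
      obtain ⟨b, rfl⟩ := hτ z
      have hb : b ∈ τ.left.base ⁻¹' T := hU ▸ Set.mem_univ b
      exact hb
    exact mem_supportedClasses_of_restrictCompl_eq_zero hT'
      (fun z hz ↦ one_le_coheight_of_mem_of_isClosed hB hT' hTne' hz) hw
  obtain ⟨a, ha, s, hs, rfl⟩ :=
    Submodule.mem_sup.1 (verticalSupportAboveMiddle_hardness hAbove hp hB τ hτ c hc hpp)
  exact Submodule.add_mem _ (supportedClasses_mono B (2 * p) hp ha) (Submodule.span_le.2 hsub hs)

/-- **The item as typed implies the Hodge conjecture for `(2,2)`-classes on fourfolds.** Granted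
Deligne's theorem on the kernel of restriction to a Zariski-open complement (Hodge III, Cor. 8.2.8:
`Deligne1974_ker_restrictCompl_eq_iSup_range_complexGysin`), the lift of Hodge classes along sums of
Gysin maps (`Voisin2025_hodgeClass_lift_complexGysin`, semisimplicity of polarisable Hodge
structures) and the Hodge conjecture in dimension `≤ 3` (Lefschetz `(1,1)` + the Lefschetz
isomorphism; `hodgeClasses_algebraic_of_dim_le_three`) — catalogued named facts of the tree;
Hironaka's projective resolution is the tree's theorem `Hironaka1964_projective_holds` —, if
`VerticalSupportAboveMiddle` holds then every rational `(2,2)`-class on every smooth projective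
fourfold `B` admitting a surjective morphism `B ⟶ ℙ⁴` is algebraic: it has coniveau `≥ 1`
(`verticalSupportAboveMiddle_coniveau_one`), so it is a sum of Gysin images of Hodge classes of
degree `≤ 2` from smooth projective varieties of dimension `≤ 3`, which are algebraic.
[cite: DeligneHodgeIII1974, Cor. 8.2.8] -/
theorem verticalSupportAboveMiddle_fourfolds (hAbove : VerticalSupportAboveMiddle)
    (hD : Deligne1974_ker_restrictCompl_eq_iSup_range_complexGysin)
    (hV : Voisin2025_hodgeClass_lift_complexGysin) (h3 : hodgeClasses_algebraic_of_dim_le_three)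
    {B : SchemeOver ℂ} (hB : IsSmoothProjective 4 B) (τ : B ⟶ projectiveSpace 4 ℂ)
    (hτ : Function.Surjective τ.left.base) (c : complexBetti B (2 * 2)) (hc : IsRationalClass c)
    (hpp : IsOfHodgeType 4 B (2 * 2) 2 2 c) : c ∈ algebraicClasses B 2 := by
  let μ : OrientationFamily := fun n Y hY ↦ (Motives.ComplexPoints.isOrientableOver ℂ hY).some
  have hμ : μ.HasPoincareDuality := OrientationFamily.hasPoincareDuality μ
  have hS := gysinMap_restrictCompl_eq_zero_of_field.{0, 0} ℂ
  have hB' : IsSmoothProjective (2 * 2) B := hB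
  have hsupp : c ∈ supportedClasses B (2 * 2) 1 :=
    verticalSupportAboveMiddle_coniveau_one hAbove (p := 2) (by norm_num) hB' τ hτ c hc hpp
  refine supportedHodgeClass_mem_algebraicClasses_of_hodgeConjectureFor_lt hD hV
    Literature.AlgebraicGeometry.Resolution.Hironaka1964_projective_holds hS μ hμ hB' ?_ 2 c hc
    hpp hsupp
  intro m Y hm hY
  exact ⟨nonempty_hodgeModel_holds hY, fun q d hd hdd ↦ h3 (by omega) hY q d hd hdd⟩

/-! ### Unconditional forms: every smooth projective variety maps finitely onto `ℙ^{dim}` -/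

/-- **If the item holds, every rational middle-degree Hodge class on every even-dimensional smooth
projective complex variety has coniveau `≥ 1`** (dies off a proper Zariski-closed subset): the
surjection `τ : B ⟶ ℙ²ᵖ` of `verticalSupportAboveMiddle_coniveau_one` always exists — a finite one,
by projective Noether normalisation (the tree's theorem
`IsSmoothProjective.exists_isFinite_surjective_hom`, Görtz–Wedhorn I Thm. 13.89). This is the
Hodge conjecture in the middle degree read through Deligne's coniveau/descent theorem, open from
fourfolds on. [cite: GortzWedhorn2020, Thm. 13.89] -/
theorem verticalSupportAboveMiddle_coniveau_one_of_even (hAbove : VerticalSupportAboveMiddle)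
    {p : ℕ} (hp : 1 ≤ p) {B : SchemeOver ℂ} (hB : IsSmoothProjective (2 * p) B)
    (c : complexBetti B (2 * p)) (hc : IsRationalClass c)
    (hpp : IsOfHodgeType (2 * p) B (2 * p) p p c) :
    c ∈ supportedClasses B (2 * p) 1 := by
  obtain ⟨τ, -, hτ⟩ := hB.exists_isFinite_surjective_hom
  exact verticalSupportAboveMiddle_coniveau_one hAbove hp hB τ τ.left.surjective c hc hpp

/-- **If the item holds, then — granted Deligne's theorem on the kernel of restriction (Hodge III
Cor. 8.2.8), the Hodge-class lift along Gysin maps (Voisin) and the Hodge conjecture in dimension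
`≤ 3` — every rational `(2,2)`-class on EVERY smooth projective complex fourfold is algebraic**
(the open case of the Hodge conjecture for fourfolds; degrees `2` and `6` are classical). The
surjection `B ⟶ ℙ⁴` of `verticalSupportAboveMiddle_fourfolds` exists by projective Noether
normalisation. Hence `VerticalSupportAboveMiddle` as typed is Hodge-conjecture-hard and not the
"support theorem" it is filed as. [cite: DeligneHodgeIII1974, Cor. 8.2.8]
[cite: GortzWedhorn2020, Thm. 13.89] -/
theorem verticalSupportAboveMiddle_hodge_two_two (hAbove : VerticalSupportAboveMiddle)
    (hD : Deligne1974_ker_restrictCompl_eq_iSup_range_complexGysin)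
    (hV : Voisin2025_hodgeClass_lift_complexGysin) (h3 : hodgeClasses_algebraic_of_dim_le_three)
    {B : SchemeOver ℂ} (hB : IsSmoothProjective 4 B) (c : complexBetti B (2 * 2))
    (hc : IsRationalClass c) (hpp : IsOfHodgeType 4 B (2 * 2) 2 2 c) :
    c ∈ algebraicClasses B 2 := by
  obtain ⟨τ, -, hτ⟩ := hB.exists_isFinite_surjective_hom
  exact verticalSupportAboveMiddle_fourfolds hAbove hD hV h3 hB τ τ.left.surjective c hc hpp

end Summit.HodgeConjecture.HodgeConjecture.Theorems

end
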